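import Literature.MathematicalPhysics.QuantumFieldTheory.Balaban1983to89.B11TracePairingLetters
import Literature.MathematicalPhysics.QuantumFieldTheory.Balaban1983to89.Beta.TransportVertices
import HarnessLib

/-!
# `PlaquetteHessianCovariantCurl` — THE SECOND TAYLOR COEFFICIENT OF A PLAQUETTE WORD IS THE COVARIANT CURL SQUARED, UP TO
# `2N·‖U(∂p) − 1‖·(Σ‖u_b‖)²`: the non-abelian cross terms are COMMUTATORS and drop out of the trace (brick (A2) of the residual crux (A)
# «on-event Hessian bound» of the crux idea «gross-sd-transfer»)

Cell `ym3-torus` (YM ladder rung R3 = continuum SU(2) Yang–Mills on T³ — a RUNG, NOT the Clay problem: not d = 4, not infinite volume, not a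
mass gap), crux of record `UnitScaleTilt.HistoryTailL` (stmt-QuantumFields-19936), width seat `ym-ust-19936-w2` (gen 14).  Ideator ym-r3-idea-2 g15
2026-08-29T17:10:36Z located the residual non-abelian crux of the LINE 28 candidate («gross-sd-transfer», `Cruxes/HistoryTailL/Ideas/gross-sd-transfer.md`)
as ONE LINE: **(A) the ON-EVENT Hessian bound** `sup_{U ∈ G} |∂_u∂_u A_W(U)| ≤ (1+ε)·‖du‖₂² + (lower order)` for the Wilson action `A_W` along a test
direction `u`, on the hierarchical small-field event `G` — versus the GLOBAL bound `|∂_u∂_u A_W| ≤ K(u) = Σ_p (Σ_{i≤4} ‖u_{b_i(p)}‖)²` (px17 g7), which sees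
the 1-form norm of `u` and loses the Poincaré factor `n²`.  This file is the algebraic heart of (A): per plaquette, the second Taylor coefficient IS the
covariant curl squared, and the non-abelian cross terms cost only `‖U(∂p) − 1‖`.

THE COMPUTATION (print: [GrossCMP1983] L. Gross, CMP 92 (1983) 137–162, proof of Thm 2.2 p. 143: for U(1), `∂_c∂_c A = Σ_p (dc)_p² cos θ_p ≤ ‖dc‖²`
— the Hessian sees only the 2-form `dc`; [Balaban1985Averaging] (19) p. 21 for the trace ∕ operator-norm letters).  Along the simultaneous left flows
`U_{b_i} ↦ e^{t u_i}U_{b_i}` a plaquette word `U₁U₂U₃⁻¹U₄⁻¹` becomes `e^{tX₁}e^{tX₂}e^{tX₃}e^{tX₄}·W`, `W = U(∂p)`, with the TRANSPORTED directions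
`X₁ = u₁`, `X₂ = U₁u₂U₁*`, `X₃ = −(U₁U₂U₃*)u₃(U₁U₂U₃*)*`, `X₄ = −Wu₄W*` (§3, `word_flow_eq`).  The second Taylor coefficient of
`t ↦ e^{tX₁}e^{tX₂}e^{tX₃}e^{tX₄}` is the ORDERED quadratic `S₂ = Σᵢ Xᵢ² + 2Σ_{i<k} XᵢX_k`, and
  `S₂ = Y² + Z`,  `Y := Σᵢ Xᵢ` (the covariant curl `(D_U u)_p` in the corner frame),  `Z := Σ_{i<k} [Xᵢ, X_k]`,  `tr Z = 0`
(§1: `secondCoeff_eq_sq_add_comm`, `trace_commFour_eq_zero`).  Hence, for ANY matrix `W` (§2, ★★★ `abs_re_trace_secondCoeff_mul_sub_le`):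
  `|Re tr(S₂·W) − Re tr(Y²)| ≤ 2·N·‖W − 1‖·(Σᵢ ‖Xᵢ‖)²`
(`S₂W − Y² = (Y² + Z)(W − 1) + Z`, `Re tr Z = 0`, `|Re tr M| ≤ N‖M‖` = lit ✓`B11TracePairingLetters.abs_re_trace_le`, `‖Y² + Z‖ ≤ 2(Σ‖Xᵢ‖)²`), and for
anti-Hermitian `Y` the main term is MINUS the Hilbert–Schmidt norm: `Re tr(Y²) = −trPair Y Y = −Σ_{ij}|Y_{ij}|² ≤ 0` (§2, `re_trace_sq_eq_neg_trPair`;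
lit `B11TracePairing.trPair`).  Reading for the Wilson action `A_W = Σ_p (1 − N⁻¹Re tr U(∂p))` (the derivative ↔ `S₂` dictionary is px17 g7's FILE 2, not
restated here): per plaquette `Hess_p(u) = N⁻¹·‖(D_U u)_p‖²_{HS} + ρ_p`, `|ρ_p| ≤ 2·dist₁(U(∂p))·(Σᵢ‖u_{bᵢ}‖)²` (§2, ★★ `hessianReading_le`), so on the event
«every plaquette meeting `supp u` is `θ`-small» `Hess_U(u) ≤ N⁻¹Σ_p‖(D_U u)_p‖²_{HS} + 2θ·K(u)` with `K(u)` the global constant — and (A) follows from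
(A2) + (A3) «`‖D_U u‖ ≤ (1+ε)‖du‖` in the block-axial gauge, `K(u) ≤ 16n²‖du‖²` by tree-gauge Poincaré» (separate bricks).

WHAT THIS FILE PROVES (kernel; 0 `def`, 0 `sorry`; `Matrix n n ℂ` with the tree's `L²`-operator norm, `n : Type` any `Fintype`):
* §1 algebra: ★`secondCoeff_eq_sq_add_comm` (`S₂ = Y² + Z`, by `noncomm_ring`), ★`trace_commFour_eq_zero`, `re_trace_commFour_eq_zero`, the norm letters
  `norm_sq_sum_le`, `norm_commFour_le`, ★`norm_sq_add_commFour_le` (`‖Y² + Z‖ ≤ 2(Σ‖Xᵢ‖)²`).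
* §2 ★★★`abs_re_trace_secondCoeff_mul_sub_le` (any `W`), ★`re_trace_sq_eq_neg_trPair` + `re_trace_sq_nonpos` (anti-Hermitian `Y`),
  ★★`hessianReading_le` (`|(−N⁻¹Re tr(S₂W)) − N⁻¹·trPair Y Y| ≤ 2‖W − 1‖(Σ‖Xᵢ‖)²`, the per-plaquette Hessian of `1 − N⁻¹Re tr` against the covariant curl).
* §3 ★`word_flow_eq` (the transported form of the flowed plaquette word, for unitary `Uᵢ` and arbitrary `Eᵢ` in place of `e^{tuᵢ}`: pure group algebra),
  `norm_conj_eq'` (`‖VuV*‖ = ‖u‖` for unitary `V`: the transports do not change the sizes entering `K(u)`).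
* §4 THE LIST FORM over the tree's ordered-exponential calculus (lit ✓`Beta.TransportVertices`: `commSum`, `size`, `D₂_zero : D₂ l 0 = l.sum * l.sum + commSum l`):
  ★`trace_commSum_list_eq_zero` (any list), ★★★`abs_re_trace_sqAddCommSum_mul_sub_le (l) (W) : |Re tr((l.sum² + commSum l)·W) − Re tr(l.sum²)| ≤ 2N‖W − 1‖(size l)²`
  — ANY number of letters (loops of any length, e.g. the (0.4) loop words), the shape px10 g7's (A1) `(d∕ds)²|₀A_W(U_s)` consumes by name via `D₂_zero`.

HONEST FRAMING.  Finite-dimensional matrix algebra; a helper toward an UNREGISTERED idea's residual crux ((A) of LINE 28); `--supports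
stmt-QuantumFields-19936`.  It proves no stub, crux, rung or summit statement; (A) itself (the on-event bound with `(1+ε)‖du‖²`), (A3), S_dom, S_lin (M3),
«ShallowFluxSecondMomentL», (Q), K1, `MeanDeviationL`, `HistoryTailL` are NOT proved; the Yang–Mills mass gap is NOT proved.

References: [GrossCMP1983] L. Gross, Convergence of U(1)₃ lattice gauge theory to its continuum limit, CMP 92 (1983) 137–162, Thm 2.2 and its proof
p. 143; [Balaban1985Averaging] T. Bałaban, CMP 98 (1985) 17–51, (19) p. 21.
-/

noncomputable section

open scoped BigOperators Matrix ComplexConjugate Matrix.Norms.L2Operator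

namespace Summit.QuantumFields.YangMills.Theorems.PlaquetteHessianCovariantCurl

open Literature.MathematicalPhysics.QuantumFieldTheory.Balaban1983to89
open Literature.MathematicalPhysics.QuantumFieldTheory.Balaban1983to89.B11TracePairing
open Literature.MathematicalPhysics.QuantumFieldTheory.Balaban1983to89.B11TracePairingLetters

variable {n : Type} [Fintype n] [DecidableEq n]

/-! ## §1 Algebra: the ordered second coefficient is the square of the sum plus traceless commutators -/

/-- **`S₂ = Y² + Z`**: the ordered second Taylor coefficient `Σᵢ Xᵢ² + 2Σ_{i<k} XᵢX_k` of `e^{tX₁}e^{tX₂}e^{tX₃}e^{tX₄}` equals `(ΣXᵢ)² + Σ_{i<k}[Xᵢ, X_k]`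
(free-ring identity). [cite: GrossCMP1983, proof of Thm 2.2 p.143 (the second derivative of the plaquette energy)] -/
theorem secondCoeff_eq_sq_add_comm (X₁ X₂ X₃ X₄ : Matrix n n ℂ) :
    X₁ * X₁ + X₂ * X₂ + X₃ * X₃ + X₄ * X₄ +
        2 • (X₁ * X₂ + X₁ * X₃ + X₁ * X₄ + X₂ * X₃ + X₂ * X₄ + X₃ * X₄) =
      (X₁ + X₂ + X₃ + X₄) * (X₁ + X₂ + X₃ + X₄) +
        ((X₁ * X₂ - X₂ * X₁) + (X₁ * X₃ - X₃ * X₁) + (X₁ * X₄ - X₄ * X₁) + (X₂ * X₃ - X₃ * X₂) + (X₂ * X₄ - X₄ * X₂) +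
          (X₃ * X₄ - X₄ * X₃)) := by
  noncomm_ring

omit [DecidableEq n] in
/-- **Commutators are traceless**: `tr(Σ_{i<k}[Xᵢ, X_k]) = 0`. [folklore] -/
theorem trace_commFour_eq_zero (X₁ X₂ X₃ X₄ : Matrix n n ℂ) :
    Matrix.trace ((X₁ * X₂ - X₂ * X₁) + (X₁ * X₃ - X₃ * X₁) + (X₁ * X₄ - X₄ * X₁) + (X₂ * X₃ - X₃ * X₂) + (X₂ * X₄ - X₄ * X₂) +
        (X₃ * X₄ - X₄ * X₃)) = 0 := by
  simp only [Matrix.trace_add, Matrix.trace_sub, Matrix.trace_mul_comm X₁ X₂, Matrix.trace_mul_comm X₁ X₃, Matrix.trace_mul_comm X₁ X₄,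
    Matrix.trace_mul_comm X₂ X₃, Matrix.trace_mul_comm X₂ X₄, Matrix.trace_mul_comm X₃ X₄, sub_self, add_zero]

omit [DecidableEq n] in
/-- Real part of the commutator trace vanishes. [folklore] -/
theorem re_trace_commFour_eq_zero (X₁ X₂ X₃ X₄ : Matrix n n ℂ) :
    (Matrix.trace ((X₁ * X₂ - X₂ * X₁) + (X₁ * X₃ - X₃ * X₁) + (X₁ * X₄ - X₄ * X₁) + (X₂ * X₃ - X₃ * X₂) + (X₂ * X₄ - X₄ * X₂) +
        (X₃ * X₄ - X₄ * X₃))).re = 0 := by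
  rw [trace_commFour_eq_zero, Complex.zero_re]

/-- `‖Y²‖ ≤ (Σ‖Xᵢ‖)²` for `Y = ΣXᵢ`. [folklore] -/
theorem norm_sq_sum_le (X₁ X₂ X₃ X₄ : Matrix n n ℂ) :
    ‖(X₁ + X₂ + X₃ + X₄) * (X₁ + X₂ + X₃ + X₄)‖ ≤ (‖X₁‖ + ‖X₂‖ + ‖X₃‖ + ‖X₄‖) ^ 2 := by
  have hY : ‖X₁ + X₂ + X₃ + X₄‖ ≤ ‖X₁‖ + ‖X₂‖ + ‖X₃‖ + ‖X₄‖ :=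
    (norm_add_le _ _).trans (add_le_add ((norm_add_le _ _).trans (add_le_add (norm_add_le _ _) le_rfl)) le_rfl)
  calc ‖(X₁ + X₂ + X₃ + X₄) * (X₁ + X₂ + X₃ + X₄)‖ ≤ ‖X₁ + X₂ + X₃ + X₄‖ * ‖X₁ + X₂ + X₃ + X₄‖ := norm_mul_le _ _
    _ ≤ (‖X₁‖ + ‖X₂‖ + ‖X₃‖ + ‖X₄‖) * (‖X₁‖ + ‖X₂‖ + ‖X₃‖ + ‖X₄‖) := by gcongr
    _ = _ := by ring

/-- `‖Σ_{i<k}[Xᵢ, X_k]‖ ≤ 2Σ_{i<k}‖Xᵢ‖‖X_k‖ ≤ (Σ‖Xᵢ‖)²`. [folklore] -/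
theorem norm_commFour_le (X₁ X₂ X₃ X₄ : Matrix n n ℂ) :
    ‖(X₁ * X₂ - X₂ * X₁) + (X₁ * X₃ - X₃ * X₁) + (X₁ * X₄ - X₄ * X₁) + (X₂ * X₃ - X₃ * X₂) + (X₂ * X₄ - X₄ * X₂) +
        (X₃ * X₄ - X₄ * X₃)‖ ≤ (‖X₁‖ + ‖X₂‖ + ‖X₃‖ + ‖X₄‖) ^ 2 := by
  have hc : ∀ A B : Matrix n n ℂ, ‖A * B - B * A‖ ≤ 2 * (‖A‖ * ‖B‖) := fun A B =>
    calc ‖A * B - B * A‖ ≤ ‖A * B‖ + ‖B * A‖ := norm_sub_le _ _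
      _ ≤ ‖A‖ * ‖B‖ + ‖B‖ * ‖A‖ := add_le_add (norm_mul_le _ _) (norm_mul_le _ _)
      _ = 2 * (‖A‖ * ‖B‖) := by ring
  have h1 := norm_nonneg X₁; have h2 := norm_nonneg X₂; have h3 := norm_nonneg X₃; have h4 := norm_nonneg X₄
  calc ‖(X₁ * X₂ - X₂ * X₁) + (X₁ * X₃ - X₃ * X₁) + (X₁ * X₄ - X₄ * X₁) + (X₂ * X₃ - X₃ * X₂) + (X₂ * X₄ - X₄ * X₂) +
        (X₃ * X₄ - X₄ * X₃)‖
      ≤ ‖X₁ * X₂ - X₂ * X₁‖ + ‖X₁ * X₃ - X₃ * X₁‖ + ‖X₁ * X₄ - X₄ * X₁‖ + ‖X₂ * X₃ - X₃ * X₂‖ + ‖X₂ * X₄ - X₄ * X₂‖ +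
        ‖X₃ * X₄ - X₄ * X₃‖ :=
        (norm_add_le _ _).trans (add_le_add ((norm_add_le _ _).trans (add_le_add ((norm_add_le _ _).trans (add_le_add
          ((norm_add_le _ _).trans (add_le_add ((norm_add_le _ _).trans (add_le_add le_rfl le_rfl)) le_rfl)) le_rfl)) le_rfl)) le_rfl)
    _ ≤ 2 * (‖X₁‖ * ‖X₂‖) + 2 * (‖X₁‖ * ‖X₃‖) + 2 * (‖X₁‖ * ‖X₄‖) + 2 * (‖X₂‖ * ‖X₃‖) + 2 * (‖X₂‖ * ‖X₄‖) + 2 * (‖X₃‖ * ‖X₄‖) := by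
        gcongr <;> exact hc _ _
    _ ≤ (‖X₁‖ + ‖X₂‖ + ‖X₃‖ + ‖X₄‖) ^ 2 := by nlinarith [sq_nonneg ‖X₁‖, sq_nonneg ‖X₂‖, sq_nonneg ‖X₃‖, sq_nonneg ‖X₄‖]

/-- **`‖Y² + Z‖ ≤ 2(Σ‖Xᵢ‖)²`.** [folklore] -/
theorem norm_sq_add_commFour_le (X₁ X₂ X₃ X₄ : Matrix n n ℂ) :
    ‖(X₁ + X₂ + X₃ + X₄) * (X₁ + X₂ + X₃ + X₄) +
        ((X₁ * X₂ - X₂ * X₁) + (X₁ * X₃ - X₃ * X₁) + (X₁ * X₄ - X₄ * X₁) + (X₂ * X₃ - X₃ * X₂) + (X₂ * X₄ - X₄ * X₂) +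
          (X₃ * X₄ - X₄ * X₃))‖ ≤ 2 * (‖X₁‖ + ‖X₂‖ + ‖X₃‖ + ‖X₄‖) ^ 2 := by
  refine (norm_add_le _ _).trans ?_
  have := norm_sq_sum_le X₁ X₂ X₃ X₄
  have := norm_commFour_le X₁ X₂ X₃ X₄
  linarith

/-! ## §2 The second coefficient against a near-identity plaquette: the covariant curl squared, up to `2N‖W − 1‖(Σ‖Xᵢ‖)²` -/

/-- **THE SECOND TAYLOR COEFFICIENT OF A PLAQUETTE WORD IS THE COVARIANT CURL SQUARED, UP TO `2N·‖W − 1‖·(Σ‖Xᵢ‖)²`.**  For ANY matrices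
`X₁ … X₄, W ∈ M_N(ℂ)`, with `S₂ = ΣXᵢ² + 2Σ_{i<k}XᵢX_k` the ordered second coefficient and `Y = ΣXᵢ`:
`|Re tr(S₂·W) − Re tr(Y²)| ≤ 2·N·‖W − 1‖·(Σ‖Xᵢ‖)²` — because `S₂W − Y² = (Y² + Z)(W − 1) + Z` with `Z = Σ_{i<k}[Xᵢ, X_k]` TRACELESS: at a flat
plaquette (`W = 1`) the non-abelian cross terms drop out of the trace exactly, and a plaquette within `‖W − 1‖` of flat costs only that much — the
U(1) mechanism «`∂_c∂_cA` sees only the 2-form» restored on the small-field event. [cite: GrossCMP1983, proof of Thm 2.2 p.143; Balaban1985Averaging, (19) p.21] -/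
theorem abs_re_trace_secondCoeff_mul_sub_le (X₁ X₂ X₃ X₄ W : Matrix n n ℂ) :
    |(Matrix.trace ((X₁ * X₁ + X₂ * X₂ + X₃ * X₃ + X₄ * X₄ +
          2 • (X₁ * X₂ + X₁ * X₃ + X₁ * X₄ + X₂ * X₃ + X₂ * X₄ + X₃ * X₄)) * W)).re -
        (Matrix.trace ((X₁ + X₂ + X₃ + X₄) * (X₁ + X₂ + X₃ + X₄))).re| ≤
      2 * Fintype.card n * ‖W - 1‖ * (‖X₁‖ + ‖X₂‖ + ‖X₃‖ + ‖X₄‖) ^ 2 := by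
  set Y : Matrix n n ℂ := X₁ + X₂ + X₃ + X₄ with hY
  set Z : Matrix n n ℂ := (X₁ * X₂ - X₂ * X₁) + (X₁ * X₃ - X₃ * X₁) + (X₁ * X₄ - X₄ * X₁) + (X₂ * X₃ - X₃ * X₂) +
    (X₂ * X₄ - X₄ * X₂) + (X₃ * X₄ - X₄ * X₃) with hZ
  rw [secondCoeff_eq_sq_add_comm]
  have e : (Y * Y + Z) * W = Y * Y + ((Y * Y + Z) * (W - 1) + Z) := by noncomm_ring
  rw [e, Matrix.trace_add, Complex.add_re, add_sub_cancel_left, Matrix.trace_add, Complex.add_re, hZ, re_trace_commFour_eq_zero, add_zero,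
    ← hZ]
  refine (abs_re_trace_le _).trans ?_
  have hN : (0 : ℝ) ≤ Fintype.card n := Nat.cast_nonneg _
  calc (Fintype.card n : ℝ) * ‖(Y * Y + Z) * (W - 1)‖ ≤ Fintype.card n * (‖Y * Y + Z‖ * ‖W - 1‖) :=
        mul_le_mul_of_nonneg_left (norm_mul_le _ _) hN
    _ ≤ Fintype.card n * (2 * (‖X₁‖ + ‖X₂‖ + ‖X₃‖ + ‖X₄‖) ^ 2 * ‖W - 1‖) := by
        gcongr
        exact norm_sq_add_commFour_le X₁ X₂ X₃ X₄
    _ = 2 * Fintype.card n * ‖W - 1‖ * (‖X₁‖ + ‖X₂‖ + ‖X₃‖ + ‖X₄‖) ^ 2 := by ring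

omit [DecidableEq n] in
/-- **For anti-Hermitian `Y` the main term is MINUS the Hilbert–Schmidt norm**: `Re tr(Y²) = −trPair Y Y = −Σ_{ij}|Y_{ij}|²` (`Yᴴ = −Y`).
[cite: Balaban1985Averaging, (19) p.21] -/
theorem re_trace_sq_eq_neg_trPair {Y : Matrix n n ℂ} (hY : Yᴴ = -Y) : (Matrix.trace (Y * Y)).re = -trPair Y Y := by
  unfold trPair
  rw [hY, neg_mul, Matrix.trace_neg, Complex.neg_re, neg_neg]

omit [DecidableEq n] in
/-- Hence `Re tr(Y²) ≤ 0` for anti-Hermitian `Y`: the flat-plaquette Hessian of `−Re tr` is nonnegative. [folklore] -/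
theorem re_trace_sq_nonpos {Y : Matrix n n ℂ} (hY : Yᴴ = -Y) : (Matrix.trace (Y * Y)).re ≤ 0 := by
  rw [re_trace_sq_eq_neg_trPair hY, neg_nonpos]
  exact trPair_self_nonneg Y

/-- **THE PER-PLAQUETTE HESSIAN READING**: for the plaquette energy `1 − N⁻¹Re tr(·)`, whose second Taylor coefficient along the flow is
`−N⁻¹Re tr(S₂·W)`, and anti-Hermitian transported directions (so `Y = (D_U u)_p` is anti-Hermitian):
`|(−N⁻¹Re tr(S₂W)) − N⁻¹·trPair Y Y| ≤ 2‖W − 1‖(Σ‖Xᵢ‖)²` — the Hessian is `N⁻¹‖(D_U u)_p‖²_{HS}` up to `2·dist₁(U(∂p))·(Σᵢ‖u_{bᵢ}‖)²`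
(`‖Xᵢ‖ = ‖uᵢ‖`, unitary transports). [cite: GrossCMP1983, proof of Thm 2.2 p.143] -/
theorem hessianReading_le [Nonempty n] (X₁ X₂ X₃ X₄ W : Matrix n n ℂ) (hY : (X₁ + X₂ + X₃ + X₄)ᴴ = -(X₁ + X₂ + X₃ + X₄)) :
    |-(((Fintype.card n : ℝ))⁻¹ * (Matrix.trace ((X₁ * X₁ + X₂ * X₂ + X₃ * X₃ + X₄ * X₄ +
          2 • (X₁ * X₂ + X₁ * X₃ + X₁ * X₄ + X₂ * X₃ + X₂ * X₄ + X₃ * X₄)) * W)).re) -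
        ((Fintype.card n : ℝ))⁻¹ * trPair (X₁ + X₂ + X₃ + X₄) (X₁ + X₂ + X₃ + X₄)| ≤
      2 * ‖W - 1‖ * (‖X₁‖ + ‖X₂‖ + ‖X₃‖ + ‖X₄‖) ^ 2 := by
  have hN : (0 : ℝ) < Fintype.card n := Nat.cast_pos.mpr Fintype.card_pos
  have h := abs_re_trace_secondCoeff_mul_sub_le X₁ X₂ X₃ X₄ W
  rw [re_trace_sq_eq_neg_trPair hY] at h
  have e : -(((Fintype.card n : ℝ))⁻¹ * (Matrix.trace ((X₁ * X₁ + X₂ * X₂ + X₃ * X₃ + X₄ * X₄ +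
          2 • (X₁ * X₂ + X₁ * X₃ + X₁ * X₄ + X₂ * X₃ + X₂ * X₄ + X₃ * X₄)) * W)).re) -
        ((Fintype.card n : ℝ))⁻¹ * trPair (X₁ + X₂ + X₃ + X₄) (X₁ + X₂ + X₃ + X₄) =
      -(((Fintype.card n : ℝ))⁻¹ * ((Matrix.trace ((X₁ * X₁ + X₂ * X₂ + X₃ * X₃ + X₄ * X₄ +
          2 • (X₁ * X₂ + X₁ * X₃ + X₁ * X₄ + X₂ * X₃ + X₂ * X₄ + X₃ * X₄)) * W)).re -
          -trPair (X₁ + X₂ + X₃ + X₄) (X₁ + X₂ + X₃ + X₄))) := by ring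
  rw [e, abs_neg, abs_mul, abs_inv, abs_of_pos hN]
  rw [inv_mul_le_iff₀ hN]
  calc |(Matrix.trace ((X₁ * X₁ + X₂ * X₂ + X₃ * X₃ + X₄ * X₄ +
          2 • (X₁ * X₂ + X₁ * X₃ + X₁ * X₄ + X₂ * X₃ + X₂ * X₄ + X₃ * X₄)) * W)).re -
          -trPair (X₁ + X₂ + X₃ + X₄) (X₁ + X₂ + X₃ + X₄)|
      ≤ 2 * Fintype.card n * ‖W - 1‖ * (‖X₁‖ + ‖X₂‖ + ‖X₃‖ + ‖X₄‖) ^ 2 := h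
    _ = Fintype.card n * (2 * ‖W - 1‖ * (‖X₁‖ + ‖X₂‖ + ‖X₃‖ + ‖X₄‖) ^ 2) := by ring

/-! ## §3 The transported form of the flowed plaquette word (group algebra, for the derivative ↔ `S₂` dictionary) -/

/-- **THE FLOWED PLAQUETTE WORD IN TRANSPORTED FORM**: for unitary `U₁ … U₄` and ANY `E₁ … E₄` (think `Eᵢ = e^{t uᵢ}`, whose adjoint is its
inverse), with `W = U₁U₂U₃*U₄*`:
`E₁U₁·E₂U₂·(E₃U₃)*·(E₄U₄)* = E₁ · (U₁E₂U₁*) · ((U₁U₂U₃*)E₃*(U₁U₂U₃*)*) · (W E₄* W*) · W` — the left flows transported to the corner frame, the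
third and fourth entering through their adjoints (hence the signs `X₃ = −Ad(·)u₃`, `X₄ = −Ad(W)u₄`). [folklore] -/
theorem word_flow_eq (U₁ U₂ U₃ U₄ E₁ E₂ E₃ E₄ : Matrix n n ℂ) (h₁ : U₁ ∈ Matrix.unitaryGroup n ℂ) (h₂ : U₂ ∈ Matrix.unitaryGroup n ℂ)
    (h₃ : U₃ ∈ Matrix.unitaryGroup n ℂ) (h₄ : U₄ ∈ Matrix.unitaryGroup n ℂ) :
    (E₁ * U₁) * (E₂ * U₂) * (E₃ * U₃)ᴴ * (E₄ * U₄)ᴴ =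
      E₁ * (U₁ * E₂ * U₁ᴴ) * ((U₁ * U₂ * U₃ᴴ) * E₃ᴴ * (U₁ * U₂ * U₃ᴴ)ᴴ) *
        ((U₁ * U₂ * U₃ᴴ * U₄ᴴ) * E₄ᴴ * (U₁ * U₂ * U₃ᴴ * U₄ᴴ)ᴴ) * (U₁ * U₂ * U₃ᴴ * U₄ᴴ) := by
  have h₁' : ∀ M : Matrix n n ℂ, U₁ᴴ * (U₁ * M) = M := fun M => by
    rw [← Matrix.mul_assoc, ← Matrix.star_eq_conjTranspose, Matrix.mem_unitaryGroup_iff'.mp h₁, Matrix.one_mul]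
  have h₂' : ∀ M : Matrix n n ℂ, U₂ᴴ * (U₂ * M) = M := fun M => by
    rw [← Matrix.mul_assoc, ← Matrix.star_eq_conjTranspose, Matrix.mem_unitaryGroup_iff'.mp h₂, Matrix.one_mul]
  have h₃' : ∀ M : Matrix n n ℂ, U₃ * (U₃ᴴ * M) = M := fun M => by
    rw [← Matrix.mul_assoc, ← Matrix.star_eq_conjTranspose, Matrix.mem_unitaryGroup_iff.mp h₃, Matrix.one_mul]
  have h₄'' : U₄ * U₄ᴴ = 1 := by rw [← Matrix.star_eq_conjTranspose]; exact Matrix.mem_unitaryGroup_iff.mp h₄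
  simp only [Matrix.conjTranspose_mul, Matrix.conjTranspose_conjTranspose, Matrix.mul_assoc, h₁', h₂', h₃', h₄'', Matrix.mul_one]

/-- The transports do not change sizes: `‖V u Vᴴ‖ = ‖u‖` for unitary `V` (so `‖Xᵢ‖ = ‖uᵢ‖` in `K(u)`). [folklore] -/
theorem norm_conj_eq' (V u : Matrix n n ℂ) (hV : V ∈ Matrix.unitaryGroup n ℂ) : ‖V * u * Vᴴ‖ = ‖u‖ := by
  have hV' : Vᴴ ∈ Matrix.unitaryGroup n ℂ := by
    rw [Matrix.mem_unitaryGroup_iff, Matrix.star_eq_conjTranspose, Matrix.conjTranspose_conjTranspose,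
      ← Matrix.star_eq_conjTranspose]
    exact Matrix.mem_unitaryGroup_iff'.mp hV
  rw [CStarRing.norm_mul_mem_unitary _ hV', CStarRing.norm_mem_unitary_mul _ hV]

/-! ## §4 The list form, over the tree's ordered-exponential calculus `Beta.TransportVertices` -/

section ListForm

open Literature.MathematicalPhysics.QuantumFieldTheory.Balaban1983to89.Beta.TransportVertices

/-- **Ordered commutator sums are traceless, for ANY list**: `tr(commSum l) = 0` (`commSum (b :: l) = commSum l + (b·Σl − Σl·b)`). [folklore] -/
theorem trace_commSum_list_eq_zero (l : List (Matrix n n ℂ)) : Matrix.trace (commSum l) = 0 := by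
  induction l with
  | nil => simp
  | cons b l ih => rw [commSum_cons, Matrix.trace_add, ih, Matrix.trace_sub, Matrix.trace_mul_comm, sub_self, add_zero]

/-- **THE LIST FORM OF (A2)**: for ANY list `l` of matrices (the transported letters of a loop word of any length) and ANY `W`,
`|Re tr((l.sum² + commSum l)·W) − Re tr(l.sum²)| ≤ 2·N·‖W − 1‖·(size l)²` — the second Taylor coefficient `D₂ l 0 = l.sum² + commSum l` of the
ordered exponential product (lit ✓`Beta.TransportVertices.D₂_zero`) against a near-identity `W` is the square of the sum (the covariant curl squared,
after `Re tr`) up to `‖W − 1‖`, because `commSum` is traceless. [cite: GrossCMP1983, proof of Thm 2.2 p.143; Balaban1985Averaging, (19) p.21] -/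
theorem abs_re_trace_sqAddCommSum_mul_sub_le (l : List (Matrix n n ℂ)) (W : Matrix n n ℂ) :
    |(Matrix.trace ((l.sum * l.sum + commSum l) * W)).re - (Matrix.trace (l.sum * l.sum)).re| ≤
      2 * Fintype.card n * ‖W - 1‖ * size l ^ 2 := by
  have e : (l.sum * l.sum + commSum l) * W = l.sum * l.sum + ((l.sum * l.sum + commSum l) * (W - 1) + commSum l) := by
    noncomm_ring
  rw [e, Matrix.trace_add, Complex.add_re, add_sub_cancel_left, Matrix.trace_add, Complex.add_re, trace_commSum_list_eq_zero,
    Complex.zero_re, add_zero]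
  refine (abs_re_trace_le _).trans ?_
  have hN : (0 : ℝ) ≤ Fintype.card n := Nat.cast_nonneg _
  have hs : 0 ≤ size l := size_nonneg l
  have h1 : ‖l.sum * l.sum‖ ≤ size l ^ 2 :=
    (norm_mul_le _ _).trans (by rw [sq]; exact mul_le_mul (norm_sum_le_size l) (norm_sum_le_size l) (norm_nonneg _) hs)
  have h2 : ‖commSum l‖ ≤ size l ^ 2 := norm_commSum_le l
  calc (Fintype.card n : ℝ) * ‖(l.sum * l.sum + commSum l) * (W - 1)‖
      ≤ Fintype.card n * ((‖l.sum * l.sum‖ + ‖commSum l‖) * ‖W - 1‖) :=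
        mul_le_mul_of_nonneg_left ((norm_mul_le _ _).trans (mul_le_mul_of_nonneg_right (norm_add_le _ _) (norm_nonneg _))) hN
    _ ≤ Fintype.card n * ((size l ^ 2 + size l ^ 2) * ‖W - 1‖) := by gcongr
    _ = 2 * Fintype.card n * ‖W - 1‖ * size l ^ 2 := by ring

omit [DecidableEq n] in
/-- The list form of the main term for anti-Hermitian letters: `Re tr(l.sum²) = −trPair l.sum l.sum ≤ 0` when every letter is anti-Hermitian
(then so is the sum). [folklore] -/
theorem re_trace_sum_sq_eq_neg_trPair (l : List (Matrix n n ℂ)) (hl : ∀ b ∈ l, bᴴ = -b) :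
    (Matrix.trace (l.sum * l.sum)).re = -trPair l.sum l.sum := by
  refine re_trace_sq_eq_neg_trPair ?_
  induction l with
  | nil => simp
  | cons b l ih =>
    rw [List.sum_cons, Matrix.conjTranspose_add, hl b (by simp), ih (fun b' hb' => hl b' (by simp [hb'])), neg_add]

end ListForm

end Summit.QuantumFields.YangMills.Theorems.PlaquetteHessianCovariantCurl

end
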